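import Literature.MathematicalPhysics.KineticTheory.MetropolisOddStatistic
import Literature.Analysis.FluidPDE.HardSphereRegularGeometry
import Summits.AtomisticToContinuum.HydrodynamicLimit.Theorems.JParityClosureOddContactSymmetryTubeStatRegular
import Summits.AtomisticToContinuum.HydrodynamicLimit.Theorems.JParityClosureEvenStressEnskogClusterTransportKernel
import HarnessLib

/-!
# Regularity of the Metropolis-odd mark (`stub_metroMarkRegular`, S3b of the line
# `KineticSlabSketch` of the crux `JParityClosure.OddContactSymmetry`, stmt-AtomisticToContinuum-17722)

The Metropolis-weighted odd mark `metroOddMark σ N χ g Ψ r ϑ s z i j` of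
`Literature.MathematicalPhysics.KineticTheory.MetropolisOddStatistic`,
`χ(s, xᵢ) · g(σ³ ρ_r(xᵢ)) · Ψ(ε⁻¹ sep(xᵢ, xⱼ), vᵢ⁻, vⱼ⁻) · min(1, e^{−F})`, is

* continuous at every `(s, z)` with `z` a contact configuration of the pair `(i, j)`
  (`continuousAt_metroOddMark`): `χ, g, Ψ` are continuous; the cone-mollified empirical density
  `ρ_r` and one-particle law `h = h_{r,ϑ}` are finite averages (`integral_empiricalMeasure`) of
  continuous kernels (the minimal-image DISTANCE `Torus.euclidDist` is continuous,
  `Torus.continuous_euclidDist`), and `h(xᵢ, ·) > 0` thanks to the self term `k = i` of the average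
  (`mollLaw_pos`), so the four logarithms of the surprisal jump `F` are continuous; the reflection
  law `reflectVel n p` is jointly continuous at impact directions `n ≠ 0`
  (`continuousAt_reflectVel_comp`); and the one delicate ingredient, the minimal-image separation
  VECTOR `sep(x, y) = reprSym (x − y)` of `𝕋³`, is continuous on the chart `‖reprSym‖ < 1/2`
  (`EvenStressEnskog.continuousAt_reprSym_of_norm_lt` of
  `…Theorems.JParityClosureEvenStressEnskogClusterTransportKernel`), which contains every contact
  pair since `‖sep(xᵢ, xⱼ)‖ = ε = hsDiameter σ N ≤ σ < 1/2`;
* Borel measurable in the configuration at each fixed time (`measurable_metroOddMark`): the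
  compositional measurable blocks of `…Theorems.JParityClosureOddContactSymmetryTubeStatRegular`
  (`measurable_reprSym_comp`, `measurable_euclidDist_comp`, `measurable_reflectVel_comp`,
  `measurable_localMaxwellian_comp`) and `fun_prop`, exactly as for the rev-1 tube functional.

The registered stub `stub_metroMarkRegular` is the conjunction; it feeds the neighbour
`stub_collisionPairSumMeasurable` (measurability of the slab collision sums in the initial datum).

## References

* I. Gallagher, L. Saint-Raymond, B. Texier, *From Newton to Boltzmann* (2013), Ch. 4 intro
  (hard spheres on `𝕋^d`, minimal image), §4.1 (pre- and post-collisional velocities).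
* W. K. Hastings, *Monte Carlo sampling methods using Markov chains and their applications*,
  Biometrika 57 (1970), §2 (the acceptance `min(1, e^{−F})`).
-/

noncomputable section

open Set MeasureTheory Filter
open scoped Topology InnerProductSpace

namespace Summit.AtomisticToContinuum.HydrodynamicLimit.Theorems.OddContactSymmetryKineticSlab

open Literature.Analysis.FluidPDE Literature.MathematicalPhysics.KineticTheory

/-! ## Continuous building blocks -/

/-- The elastic reflection law `reflectVel n p` is jointly continuous in the impact direction and the
velocity pair at every nonzero impact direction (the only singularity is the division by `‖n‖²`).
[folklore] -/
theorem continuousAt_reflectVel_comp {α : Type*} [TopologicalSpace α] {n : α → V3}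
    {p : α → V3 × V3} {a : α} (hn : ContinuousAt n a) (hp : ContinuousAt p a) (h0 : n a ≠ 0) :
    ContinuousAt (fun x => reflectVel (n x) (p x)) a := by
  have hc : ContinuousAt (fun x => ⟪(p x).1 - (p x).2, n x⟫_ℝ / ‖n x‖ ^ 2) a :=
    ((hp.fst.sub hp.snd).inner hn).div (hn.norm.pow 2) (pow_ne_zero 2 (norm_ne_zero_iff.2 h0))
  unfold reflectVel
  exact (hp.fst.sub (hc.smul hn)).prodMk (hp.snd.add (hc.smul hn))

section ContinuousBlocks

variable {α : Type*} [TopologicalSpace α]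

/-- The minimal-image distance of two continuous torus-valued maps is continuous. [folklore] -/
theorem continuous_euclidDist_comp {f g : α → UnitAddTorus (Fin 3)} (hf : Continuous f)
    (hg : Continuous g) : Continuous fun a => Torus.euclidDist (f a) (g a) := by
  have h := Torus.continuous_euclidDist.comp (hf.prodMk hg)
  simpa only [Function.comp_def] using h

/-- The local Maxwellian is jointly continuous in bulk velocity and velocity. [folklore] -/
theorem continuous_localMaxwellian_comp (ρ θ : ℝ) {u v : α → V3} (hu : Continuous u)
    (hv : Continuous v) : Continuous fun a => localMaxwellian ρ θ (u a) (v a) := by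
  unfold localMaxwellian
  fun_prop

end ContinuousBlocks

attribute [local fun_prop] continuous_euclidDist_comp continuous_localMaxwellian_comp
  measurable_reprSym_comp measurable_euclidDist_comp measurable_reflectVel_comp
  measurable_localMaxwellian_comp

variable {N : ℕ}

/-- The cone-mollified empirical density `z ↦ ρ_r(xᵢ) = ∫ b_r(y, xᵢ) dμ_z(y, w)` read at the position
of particle `i` is a continuous function of the configuration (a finite average of cone kernels of
minimal-image distances). [folklore] -/
theorem continuous_mollDensity (r : ℝ) (i : Fin (N + 1)) :
    Continuous fun z : Config (N + 1) (Fin 3) T3 =>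
      ∫ q, 3 / (Real.pi * r ^ 3) * max (1 - Torus.euclidDist q.1 (z i).1 / r) 0
        ∂(empiricalMeasure z) := by
  simp only [integral_empiricalMeasure]
  fun_prop

/-- The mollified empirical one-particle law `(z, v) ↦ h(xᵢ, v) = ∫ b_r(y, xᵢ) M_{1,v,ϑ²}(w) dμ_z(y, w)`
read at the position of particle `i` is jointly continuous in the configuration and the velocity.
[folklore] -/
theorem continuous_mollLaw (r ϑ : ℝ) (i : Fin (N + 1)) :
    Continuous fun q : Config (N + 1) (Fin 3) T3 × V3 =>
      ∫ y, 3 / (Real.pi * r ^ 3) * max (1 - Torus.euclidDist y.1 (q.1 i).1 / r) 0 *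
        localMaxwellian 1 (ϑ ^ 2) q.2 y.2 ∂(empiricalMeasure q.1) := by
  simp only [integral_empiricalMeasure]
  fun_prop

/-- Compositional form of `continuous_mollLaw`: along a configuration map and a velocity selection
that are continuous at a point, the mollified law is continuous at that point. [folklore] -/
theorem continuousAt_mollLaw_comp {α : Type*} [TopologicalSpace α]
    {w : α → Config (N + 1) (Fin 3) T3} {u : α → V3} {a : α} (hw : ContinuousAt w a)
    (hu : ContinuousAt u a) (r ϑ : ℝ) (i : Fin (N + 1)) :
    ContinuousAt (fun x => ∫ y, 3 / (Real.pi * r ^ 3) * max (1 - Torus.euclidDist y.1 (w x i).1 / r) 0 *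
        localMaxwellian 1 (ϑ ^ 2) (u x) y.2 ∂(empiricalMeasure (w x))) a := by
  have h := (continuous_mollLaw r ϑ i).continuousAt.comp (hw.prodMk hu)
  simpa only [Function.comp_def] using h

/-- The mollified empirical law read at the position of a particle of the configuration is
positive at every velocity (`r, ϑ > 0`): all terms of the average are nonnegative and the self term
`k = i` is `3/(π r³) · M_{1,v,ϑ²}(vᵢ) > 0`. [folklore] -/
theorem mollLaw_pos {r ϑ : ℝ} (hr : 0 < r) (hϑ : 0 < ϑ) (z : Config (N + 1) (Fin 3) T3)
    (i : Fin (N + 1)) (v : V3) :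
    0 < ∫ y, 3 / (Real.pi * r ^ 3) * max (1 - Torus.euclidDist y.1 (z i).1 / r) 0 *
        localMaxwellian 1 (ϑ ^ 2) v y.2 ∂(empiricalMeasure z) := by
  rw [integral_empiricalMeasure]
  refine mul_pos (inv_pos.2 (by exact_mod_cast Nat.succ_pos N)) ?_
  refine Finset.sum_pos' (fun k _ => mul_nonneg (coneKernel_nonneg_le hr _ _).1
    (localMaxwellian_nonneg zero_le_one (sq_nonneg ϑ) _ _)) ⟨i, Finset.mem_univ _, ?_⟩
  rw [Torus.euclidDist_self, zero_div, sub_zero, max_eq_left zero_le_one, mul_one]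
  exact mul_pos (by positivity) (localMaxwellian_pos one_pos (pow_pos hϑ 2) _ _)

/-! ## Continuity of the mark at contact configurations -/

/-- **The Metropolis-odd mark is continuous at contact configurations.**  For `0 < σ < 1/2`,
continuous `χ, g, Ψ` and `r, ϑ > 0`, `(s, z) ↦ metroOddMark σ N χ g Ψ r ϑ s z i j` is continuous at
every `(t, z)` with `z` in the contact set of `(i, j)` (there `‖sep(xᵢ, xⱼ)‖ = hsDiameter σ N ∈ (0, 1/2)`,
so the minimal-image separation vector is continuous nearby and the impact direction is nonzero).
[folklore] -/
theorem continuousAt_metroOddMark {σ : ℝ} (hσ : 0 < σ) (hσ2 : σ < 2⁻¹) (N : ℕ)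
    {χ : ℝ × UnitAddTorus (Fin 3) → ℝ} (hχ : Continuous χ) {g : ℝ → ℝ} (hg : Continuous g)
    {Ψ : V3 × V3 × V3 → ℝ} (hΨ : Continuous Ψ) {r ϑ : ℝ} (hr : 0 < r) (hϑ : 0 < ϑ)
    {i j : Fin (N + 1)} (t : ℝ) {z : Config (N + 1) (Fin 3) T3}
    (hz : z ∈ contactSet (Torus.geometry (Fin 3)) (N + 1) (hsDiameter σ N) i j) :
    ContinuousAt (fun p : ℝ × Config (N + 1) (Fin 3) T3 => metroOddMark σ N χ g Ψ r ϑ p.1 p.2 i j)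
      (t, z) := by
  obtain ⟨-, hc⟩ := hz
  have hε : 0 < hsDiameter σ N := hsDiameter_pos hσ N
  have hn : (Torus.geometry (Fin 3)).sepVec (z i).1 (z j).1 ≠ 0 := by
    intro h
    rw [h, norm_zero] at hc
    exact hε.ne hc
  have hlt : ‖Torus.reprSym ((z i).1 - (z j).1)‖ < 1 / 2 := by
    rw [← Torus.geometry_sepVec, hc]
    have h1 := hsDiameter_le hσ.le N
    have h2 : (2⁻¹ : ℝ) = 1 / 2 := by norm_num
    linarith
  -- the minimal-image separation vector of the pair, continuous at `(t, z)`
  have hS : ContinuousAt (fun p : ℝ × Config (N + 1) (Fin 3) T3 =>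
      (Torus.geometry (Fin 3)).sepVec (p.2 i).1 (p.2 j).1) (t, z) := by
    have h2 : Continuous fun p : ℝ × Config (N + 1) (Fin 3) T3 => (p.2 i).1 - (p.2 j).1 := by
      fun_prop
    have h := ContinuousAt.comp_of_eq (EvenStressEnskog.continuousAt_reprSym_of_norm_lt hlt)
      (h2.continuousAt (x := (t, z))) rfl
    simp only [Function.comp_def] at h
    exact h
  -- the pre-collisional velocities of the pair, continuous at `(t, z)`
  have hP : ContinuousAt (fun p : ℝ × Config (N + 1) (Fin 3) T3 =>
      reflectVel ((Torus.geometry (Fin 3)).sepVec (p.2 i).1 (p.2 j).1) ((p.2 i).2, (p.2 j).2))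
      (t, z) := by
    have hv : Continuous fun p : ℝ × Config (N + 1) (Fin 3) T3 => ((p.2 i).2, (p.2 j).2) := by
      fun_prop
    exact continuousAt_reflectVel_comp hS hv.continuousAt hn
  -- the logarithm of the mollified law at `xᵢ` along a velocity selection continuous at `(t, z)`
  have hH : ∀ {u : ℝ × Config (N + 1) (Fin 3) T3 → V3}, ContinuousAt u (t, z) →
      ContinuousAt (fun p : ℝ × Config (N + 1) (Fin 3) T3 => Real.log (∫ y, 3 / (Real.pi * r ^ 3) *
        max (1 - Torus.euclidDist y.1 (p.2 i).1 / r) 0 * localMaxwellian 1 (ϑ ^ 2) (u p) y.2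
          ∂(empiricalMeasure p.2))) (t, z) := fun hu =>
    (continuousAt_mollLaw_comp continuousAt_snd hu r ϑ i).log (mollLaw_pos hr hϑ z i _).ne'
  have hVi : ContinuousAt (fun p : ℝ × Config (N + 1) (Fin 3) T3 => (p.2 i).2) (t, z) :=
    (Continuous.continuousAt (by fun_prop))
  have hVj : ContinuousAt (fun p : ℝ × Config (N + 1) (Fin 3) T3 => (p.2 j).2) (t, z) :=
    (Continuous.continuousAt (by fun_prop))
  -- the globally continuous factors
  have hA : ContinuousAt (fun p : ℝ × Config (N + 1) (Fin 3) T3 => χ (p.1, (p.2 i).1)) (t, z) :=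
    (Continuous.continuousAt (by fun_prop))
  have hGρ : ContinuousAt (fun p : ℝ × Config (N + 1) (Fin 3) T3 =>
      g (σ ^ 3 * ∫ q, 3 / (Real.pi * r ^ 3) * max (1 - Torus.euclidDist q.1 (p.2 i).1 / r) 0
        ∂(empiricalMeasure p.2))) (t, z) :=
    (hg.comp (continuous_const.mul ((continuous_mollDensity r i).comp continuous_snd))).continuousAt
  have hΨ' : ContinuousAt (fun p : ℝ × Config (N + 1) (Fin 3) T3 =>
      Ψ ((hsDiameter σ N)⁻¹ • (Torus.geometry (Fin 3)).sepVec (p.2 i).1 (p.2 j).1,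
        (reflectVel ((Torus.geometry (Fin 3)).sepVec (p.2 i).1 (p.2 j).1) ((p.2 i).2, (p.2 j).2)).1,
        (reflectVel ((Torus.geometry (Fin 3)).sepVec (p.2 i).1 (p.2 j).1) ((p.2 i).2, (p.2 j).2)).2))
      (t, z) := by
    have hSc := hS.const_smul (hsDiameter σ N)⁻¹
    have h := hΨ.continuousAt.comp (hSc.prodMk (hP.fst.prodMk hP.snd))
    simp only [Function.comp_def] at h
    exact h
  have hmin : Continuous fun y : ℝ => min 1 (Real.exp (-y)) := by fun_prop
  dsimp only [metroOddMark]
  exact (hA.mul hGρ).mul (hΨ'.mul (hmin.continuousAt.comp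
    ((((hH hP.fst).add (hH hP.snd)).sub (hH hVi)).sub (hH hVj))))

/-! ## Measurability of the mark in the configuration -/

/-- **The Metropolis-odd mark is Borel measurable in the configuration** at each fixed time, for
continuous `χ, g, Ψ` (finite averages, the measurable minimal image `Torus.measurable_reprSym`,
`Real.log`, `Real.exp`, `min`). [folklore] -/
theorem measurable_metroOddMark (σ : ℝ) (N : ℕ) {χ : ℝ × UnitAddTorus (Fin 3) → ℝ}
    (hχ : Continuous χ) {g : ℝ → ℝ} (hg : Continuous g) {Ψ : V3 × V3 × V3 → ℝ} (hΨ : Continuous Ψ)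
    (r ϑ t : ℝ) (i j : Fin (N + 1)) :
    Measurable fun z : Config (N + 1) (Fin 3) T3 => metroOddMark σ N χ g Ψ r ϑ t z i j := by
  have hχm : Measurable χ := hχ.measurable
  have hgm : Measurable g := hg.measurable
  have hΨm : Measurable Ψ := hΨ.measurable
  dsimp only [metroOddMark]
  simp only [integral_empiricalMeasure, Torus.geometry_sepVec]
  fun_prop

/-! ## The registered stub -/

/-- **S3b `stub_metroMarkRegular` — regularity of the Metropolis-odd mark.**  For `0 < σ < 1/2`, continuous
`χ, g, Ψ` and `r, ϑ > 0`, the mark `(t, z) ↦ metroOddMark … t z i j` is continuous at every `(t, z)` with `z` a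
contact configuration of `(i, j)` (the minimal-image separation is continuous near contact since
`ε ≤ σ < 1/2`; the mollified empirical laws are finite averages of continuous kernels and `h > 0`), and
`z ↦ metroOddMark … t z i j` is measurable. [folklore] -/
theorem stub_metroMarkRegular {σ : ℝ} (hσ : 0 < σ) (hσ2 : σ < 2⁻¹) (N : ℕ)
    {χ : ℝ × UnitAddTorus (Fin 3) → ℝ} (hχ : Continuous χ) {g : ℝ → ℝ} (hg : Continuous g)
    {Ψ : V3 × V3 × V3 → ℝ} (hΨ : Continuous Ψ) {r ϑ : ℝ} (hr : 0 < r) (hϑ : 0 < ϑ) :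
    (∀ i j : Fin (N + 1), i ≠ j → ∀ (t : ℝ) (z : Config (N + 1) (Fin 3) T3),
      z ∈ contactSet (Torus.geometry (Fin 3)) (N + 1) (hsDiameter σ N) i j →
      ContinuousAt (fun p : ℝ × Config (N + 1) (Fin 3) T3 => metroOddMark σ N χ g Ψ r ϑ p.1 p.2 i j) (t, z)) ∧
    (∀ (t : ℝ) (i j : Fin (N + 1)), Measurable fun z => metroOddMark σ N χ g Ψ r ϑ t z i j) :=
  ⟨fun _ _ _ t _ hz => continuousAt_metroOddMark hσ hσ2 N hχ hg hΨ hr hϑ t hz,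
    fun t i j => measurable_metroOddMark σ N hχ hg hΨ r ϑ t i j⟩

end Summit.AtomisticToContinuum.HydrodynamicLimit.Theorems.OddContactSymmetryKineticSlab

end
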